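import Literature.NumberTheory.EllipticCurves.ManinConstantAdditivePrimesProofs
import HarnessLib
/-!
# `‖u‖_p ≤ 1` at an additive prime `p ≥ 5` for an abstract short-model parametrisation package
(route `ManinLocalTwoThree`, cruxes C2 stmt-BirchSwinnertonDyer-22967 / C3 stmt-…-22968; cell bsd-f2-manin, prover p2 gen 25; CES stage 3 step (3d)).
Lattice-free twin of the tree's `padicNorm_le_one_of_neronLattice_eq_smul_periodLattice_of_dvd_of_dvd` (`ManinConstantAdditivePrimesProofs`):
its Steps 4–9 use only the SHORT-MODEL PACKAGE of `W'` (`E : y² = x³ + a₄x + a₆`, `vc • E = W'`, `z ∈ qℚ⟦q⟧` with `log_E(z) = Σ aₙ(W')qⁿ/n`,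
`z ∈ Frac ℤ⟦q⟧`), stated here for an ABSTRACT package so that it applies to the `X₁(N)`-parametrisation of the Stevens curve
(`…StevensShortModelParam`).  Proof verbatim from Step 4 on.  Fact-free; standard axioms; no definitions.  BSD is not proved by this file;
Manin's conjecture, C2 and C3 are not proved by this file. [cite: EdixhovenManin1991, Prop. 2] [cite: Honda1970, Thm. 2 (p. 223)]
[cite: SilvermanAEC2009, VII.1 Remark 1.1, VII.5.4, VII.5.5]
-/

-- lint-debt: the directory name repeats the summit name (sibling precedent `ManinLocalTwoThreeStevensCurveDatum.lean`)
set_option linter.dupNamespace false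
noncomputable section
open scoped Classical IntermediateField
open PowerSeries Literature.RingTheory.FormalGroups Literature.NumberTheory.EllipticCurves IsLocalRing _root_.WeierstrassCurve
open Literature.NumberTheory.EllipticCurves.ModularForms Literature.NumberTheory.EllipticCurves.HondaCongruence
open Literature.NumberTheory.Automorphic Literature.NumberTheory.GaloisRepresentations
namespace Summit.BirchSwinnertonDyer.BirchSwinnertonDyer.Theorems.ManinLocalTwoThree.StevensIntegrality
set_option maxHeartbeats 800000 in
/-- **`‖u(vc)‖_p ≤ 1` at an additive prime `p ≥ 5`, for an abstract SHORT-MODEL parametrisation package** (`E : y² = x³ + a₄x + a₆`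
elliptic over `ℚ`, `vc • E = W'`, `u(vc) > 0`, `z ∈ qℚ⟦q⟧` with `log_E(z) = Σ aₙ(W')qⁿ/n`, `z·Q = P`, `Q ≠ 0`; `p ≥ 5`, `p ∣ Δ_min(W')`,
`p ∣ c₄(W')`): infinite height ⇒ free Honda witness; semistable twist over `𝒪_{ℚ_p(p^{1/12})}` (`exists_semistableTwistData`); the local
lemma over `O` — the tree's proof verbatim from Step 4. [cite: EdixhovenManin1991, Prop. 2] [cite: Honda1970, Thm. 2 (p. 223)] -/
theorem padicNorm_le_one_of_shortModelParam_of_dvd_of_dvd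
    {W' : WeierstrassCurve ℚ} [W'.IsElliptic] [W'.IsGloballyMinimal]
    {a₄ a₆ : ℚ} {E : WeierstrassCurve ℚ} [E.IsElliptic]
    (hE : E = { a₁ := 0, a₂ := 0, a₃ := 0, a₄ := a₄, a₆ := a₆ })
    {z : ℚ⟦X⟧} {P Q : ℤ⟦X⟧} (hz0 : constantCoeff z = 0) (hQ : Q ≠ 0)
    (hPQ : z * Q.map (Int.castRingHom ℚ) = P.map (Int.castRingHom ℚ))
    (hlog : E.formalLog.subst z = PowerSeries.mk fun n ↦ ((W'.LFunction n : ℤ) : ℚ) / n)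
    {vc : VariableChange ℚ} (hC : vc • E = W') (hCpos : 0 < (vc.u : ℚ))
    {p : ℕ} [Fact p.Prime] (hp5 : 5 ≤ p) (hΔp : (p : ℤ) ∣ minimalDiscriminantInt W')
    (hc₄p : (p : ℤ) ∣ (integralModelInt W').c₄) :
    ‖((vc.u : ℚ) : ℚ_[p])‖ ≤ 1 := by
  have hCu0 : (vc.u : ℚ) ≠ 0 := vc.u.ne_zero
  set φ : ℚ →+* ℚ_[p] := algebraMap ℚ ℚ_[p] with hφ
  set Wp : WeierstrassCurve ℚ_[p] := W'.map φ with hWp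
  set Ep : WeierstrassCurve ℚ_[p] := E.map φ with hEp
  set Cp : VariableChange ℚ_[p] := vc.map (φ : ℚ →+* ℚ_[p]) with hCp
  have hCE : Cp • Ep = Wp := by rw [hCp, hEp, hWp, map_variableChange, hC]
  have hCpu : (Cp.u : ℚ_[p]) = ((vc.u : ℚ) : ℚ_[p]) := by simp [hCp, VariableChange.map, hφ]
  rw [← hCpu]
  have hEp' : Ep = { a₁ := 0, a₂ := 0, a₃ := 0, a₄ := (a₄ : ℚ_[p]), a₆ := (a₆ : ℚ_[p]) } := by
    simp [hEp, hE, WeierstrassCurve.map, hφ]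
  set S : VariableChange ℚ_[p] := ⟨Cp.u, 0, 0, 0⟩ with hS
  set E₀ : WeierstrassCurve ℚ_[p] := S • Ep with hE₀
  set C₀ : VariableChange ℚ_[p] := Cp * S⁻¹ with hC₀
  have hC₀E₀ : C₀ • E₀ = Wp := by rw [hC₀, hE₀, mul_smul, inv_smul_smul, hCE]
  have hC₀u : C₀.u = 1 := by simp [hC₀, hS, VariableChange.mul_def, VariableChange.inv_def]
  haveI hE₀s : E₀.IsShortNF := by
    rw [hE₀, hS, hEp', smul_shortModel]
    exact ⟨rfl, rfl, rfl⟩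
  set V : WeierstrassCurve ℤ_[p] := (integralModelInt W').map (Int.castRingHom ℤ_[p]) with hV
  have hVc : V.map PadicInt.Coe.ringHom = Wp := map_coe_integralModelInt W'
  haveI hWpI : Wp.IsIntegral ℤ_[p] := by rw [← hVc]; exact V.isIntegral_map_coe
  have hTC₀ : Wp.toShortNF * C₀ = 1 :=
    VariableChange.eq_one_of_isShortNF_smul (E := E₀) (E' := Wp.toShortNF • Wp)
      (by rw [VariableChange.mul_def]; simp [toShortNF_u, hC₀u]) (by rw [mul_smul, hC₀E₀])
  have hC₀T : C₀ = Wp.toShortNF⁻¹ := eq_inv_of_mul_eq_one_right hTC₀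
  have hE₀T : E₀ = Wp.toShortNF • Wp := by
    rw [← inv_smul_eq_iff.mpr hC₀E₀.symm, hC₀T, inv_inv]
  haveI hE₀I : E₀.IsIntegral ℤ_[p] := by rw [hE₀T]; exact Wp.isIntegral_toShortNF_smul hp5
  set ℓ : ℚ_[p]⟦X⟧ := PowerSeries.mk fun k ↦ ((W'.LFunction k : ℤ) : ℚ_[p]) / k with hℓ
  set zp : ℚ_[p]⟦X⟧ := z.map φ with hzp
  have hzs : HasSubst z := HasSubst.of_constantCoeff_zero' hz0
  have hzp0 : constantCoeff zp = 0 := by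
    rw [hzp, ← coeff_zero_eq_constantCoeff, coeff_map, coeff_zero_eq_constantCoeff, hz0, map_zero]
  have hzps : HasSubst zp := HasSubst.of_constantCoeff_zero' hzp0
  have hzp1 : coeff 1 zp = 1 := by
    have h1 := congrArg (coeff 1) hlog
    rw [coeff_one_subst_eq_mul _ hz0, coeff_one_formalLog, one_mul, coeff_mk, Nat.cast_one,
      div_one, W'.isMultiplicative_LFunction.map_one, Int.cast_one] at h1
    rw [hzp, coeff_map, h1, map_one]
  have hlogp : Ep.formalLog.subst zp = ℓ := by
    rw [hzp, hEp, ← E.map_formalLog φ, ← powerSeries_map_subst hzs φ, hlog]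
    ext n
    rw [coeff_map, coeff_mk, coeff_mk, map_div₀, map_natCast, map_intCast]
  set z₀ : ℚ_[p]⟦X⟧ := C (Cp.u : ℚ_[p]) * zp with hz₀
  have hz₀0 : constantCoeff z₀ = 0 := by rw [hz₀, map_mul, hzp0, mul_zero]
  have hz₀s : HasSubst z₀ := HasSubst.of_constantCoeff_zero' hz₀0
  have hz₀1 : coeff 1 z₀ = (Cp.u : ℚ_[p]) := by rw [hz₀, coeff_C_mul, hzp1, mul_one]
  have hlog₀ : E₀.formalLog.subst z₀ = C (Cp.u : ℚ_[p]) * ℓ := by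
    rw [hE₀, hz₀, hS, Ep.formalLog_uScale_smul_subst Cp.u hzp0, hlogp]
  obtain ⟨V₀, hV₀⟩ := hE₀I.integral
  have hV₀c : V₀.map PadicInt.Coe.ringHom = E₀ := hV₀.symm
  haveI hV₀s : (V₀.map PadicInt.Coe.ringHom).IsShortNF := by rw [hV₀c]; infer_instance
  have hWc₄ : Wp.c₄ = (((integralModelInt W').c₄ : ℤ) : ℚ_[p]) := by
    have hc : W'.c₄ = ((integralModelInt W').c₄ : ℚ) := by
      conv_lhs => rw [← map_integralModelInt W']
      rw [map_c₄, eq_intCast]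
    rw [hWp, map_c₄, hc, hφ, eq_ratCast, Rat.cast_intCast]
  have hWΔ : Wp.Δ = ((minimalDiscriminantInt W' : ℤ) : ℚ_[p]) := by
    rw [hWp, map_Δ, ← cast_minimalDiscriminantInt, hφ, eq_ratCast, Rat.cast_intCast]
  have hWpΔ0 : Wp.Δ ≠ 0 := by
    rw [hWΔ, Int.cast_ne_zero]; exact minimalDiscriminantInt_ne_zero W'
  have hE₀c₄ : E₀.c₄ = Wp.c₄ := by
    rw [hE₀T, variableChange_c₄, toShortNF_u, inv_one, Units.val_one, one_pow, one_mul]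
  have hE₀Δ : E₀.Δ = Wp.Δ := by
    rw [hE₀T, variableChange_Δ, toShortNF_u, inv_one, Units.val_one, one_pow, one_mul]
  have hnc₄ : ‖(V₀.map PadicInt.Coe.ringHom).c₄‖ < 1 := by
    rw [hV₀c, hE₀c₄, hWc₄]; exact Padic.norm_intCast_lt_one_iff.mpr hc₄p
  have hnΔ : ‖(V₀.map PadicInt.Coe.ringHom).Δ‖ < 1 := by
    rw [hV₀c, hE₀Δ, hWΔ]; exact Padic.norm_intCast_lt_one_iff.mpr hΔp
  have h0 : (V₀.map PadicInt.toZMod).formalMul p = 0 :=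
    formalMul_prime_map_toZMod_eq_zero_of_isShortNF hp5 V₀ hnc₄ hnΔ
  have hℓ0 : constantCoeff ℓ = 0 := by
    rw [hℓ, ← coeff_zero_eq_constantCoeff_apply, coeff_mk, Nat.cast_zero, div_zero]
  have hℓint : ∀ n, ‖coeff n ℓ‖ ≤ 1 := W'.norm_coeff_lSeriesLog_le_one_of_dvd_of_dvd p hΔp hc₄p
  obtain ⟨ψ, hψ0, hψi, hψ⟩ :=
    V₀.exists_padicInt_formalLog_subst_eq_of_formalMul_prime_eq_zero h0 hℓ0 hℓint
  rw [hV₀c] at hψ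
  have hψs : HasSubst ψ := HasSubst.of_constantCoeff_zero' hψ0
  have hψI : IsPadicInt ψ := isPadicInt_iff_coeff.mpr hψi
  set d : ℕ := (vc.u : ℚ).den with hd
  have hd0 : 0 < d := (vc.u : ℚ).den_pos
  have hnum : 0 < (vc.u : ℚ).num := Rat.num_pos.mpr hCpos
  set n₁ : ℕ := (vc.u : ℚ).num.toNat with hn₁
  have hn₁z : ((n₁ : ℕ) : ℤ) = (vc.u : ℚ).num := Int.toNat_of_nonneg hnum.le
  have hdu : (d : ℚ_[p]) * (Cp.u : ℚ_[p]) = (n₁ : ℚ_[p]) := by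
    have h : ((vc.u : ℚ)) * d = ((vc.u : ℚ).num : ℚ) := Rat.mul_den_eq_num _
    rw [← hn₁z] at h
    have h' := congrArg (fun r : ℚ ↦ (r : ℚ_[p])) h
    simp only [Rat.cast_mul, Rat.cast_natCast, Int.cast_natCast] at h'
    rw [hCpu, mul_comm]
    exact h'
  set w : ℚ_[p]⟦X⟧ := (E₀.formalMul n₁).subst ψ with hw
  have hwI : IsPadicInt w := (E₀.isPadicInt_formalMul n₁).powerSeries_subst hψI hψs
  have hw0 : constantCoeff w = 0 :=
    (Literature.NumberTheory.EllipticCurves.constantCoeff_subst_of_constantCoeff_eq_zero hψ0).trans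
      (E₀.constantCoeff_formalMul n₁)
  have hlogw : E₀.formalLog.subst w = n₁ • ℓ := by
    rw [hw, ← subst_comp_subst_apply (E₀.hasSubst_formalMul n₁) hψs, E₀.formalLog_subst_formalMul n₁,
      ← coe_substAlgHom hψs, map_nsmul, coe_substAlgHom, hψ]
  have hdz0 : constantCoeff ((E₀.formalMul d).subst z₀) = 0 :=
    (Literature.NumberTheory.EllipticCurves.constantCoeff_subst_of_constantCoeff_eq_zero hz₀0).trans
      (E₀.constantCoeff_formalMul d)
  have hlogd : E₀.formalLog.subst ((E₀.formalMul d).subst z₀) = n₁ • ℓ := by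
    rw [← subst_comp_subst_apply (E₀.hasSubst_formalMul d) hz₀s, E₀.formalLog_subst_formalMul d,
      ← coe_substAlgHom hz₀s, map_nsmul, coe_substAlgHom, hlog₀, nsmul_eq_mul, nsmul_eq_mul,
      ← mul_assoc, ← map_natCast (C : ℚ_[p] →+* ℚ_[p]⟦X⟧) d, ← map_mul, hdu, map_natCast]
  have hGw : (E₀.formalMul d).subst z₀ = w := E₀.eq_of_formalLog_subst_eq hdz0 hw0 (hlogd.trans hlogw.symm)
  obtain ⟨w₁, hw₁⟩ := isPadicInt_iff_exists_powerSeries_map.mp hwI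
  set Q₁ : ℤ_[p]⟦X⟧ := C (d : ℤ_[p]) * Q.map (Int.castRingHom ℤ_[p]) with hQ₁
  set P₁ : ℤ_[p]⟦X⟧ := C (n₁ : ℤ_[p]) * P.map (Int.castRingHom ℤ_[p]) with hP₁
  have hintQ : ∀ R : ℤ⟦X⟧, (R.map (Int.castRingHom ℤ_[p])).map (algebraMap ℤ_[p] ℚ_[p]) =
      (R.map (Int.castRingHom ℚ)).map φ := fun R ↦ by
    ext n
    simp [coeff_map]
  have hPQp : zp * (Q.map (Int.castRingHom ℚ)).map φ = (P.map (Int.castRingHom ℚ)).map φ := by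
    rw [hzp, ← map_mul, hPQ]
  have hQ₁0 : Q₁ ≠ 0 := by
    rw [hQ₁]
    refine mul_ne_zero ?_ ?_
    · intro h0'
      have h := congrArg constantCoeff h0'
      rw [constantCoeff_C, map_zero, Nat.cast_eq_zero] at h
      exact hd0.ne' h
    · intro h0'
      apply hQ
      apply PowerSeries.map_injective (Int.castRingHom ℤ_[p]) Int.cast_injective
      rw [h0', map_zero]
  have hPQ₁ : z₀ * Q₁.map (algebraMap ℤ_[p] ℚ_[p]) = P₁.map (algebraMap ℤ_[p] ℚ_[p]) := by
    have e₁ : Q₁.map (algebraMap ℤ_[p] ℚ_[p]) = C (d : ℚ_[p]) * (Q.map (Int.castRingHom ℚ)).map φ := by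
      rw [hQ₁, map_mul, map_C, map_natCast (algebraMap ℤ_[p] ℚ_[p]) d, hintQ]
    have e₂ : P₁.map (algebraMap ℤ_[p] ℚ_[p]) = C (n₁ : ℚ_[p]) * (P.map (Int.castRingHom ℚ)).map φ := by
      rw [hP₁, map_mul, map_C, map_natCast (algebraMap ℤ_[p] ℚ_[p]) n₁, hintQ]
    have e₃ : C (Cp.u : ℚ_[p]) * C (d : ℚ_[p]) = (C (n₁ : ℚ_[p]) : ℚ_[p]⟦X⟧) := by
      rw [← map_mul, mul_comm, hdu]
    rw [e₁, e₂, hz₀, mul_mul_mul_comm, e₃, hPQp]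
  have hV₁ : V₀.a₁ = 0 := by
    have h := (V₀.map PadicInt.Coe.ringHom).a₁_of_isShortNF
    rw [map_a₁] at h
    exact PadicInt.coe_eq_zero.mp h
  have hV₂ : V₀.a₂ = 0 := by
    have h := (V₀.map PadicInt.Coe.ringHom).a₂_of_isShortNF
    rw [map_a₂] at h
    exact PadicInt.coe_eq_zero.mp h
  have hV₃ : V₀.a₃ = 0 := by
    have h := (V₀.map PadicInt.Coe.ringHom).a₃_of_isShortNF
    rw [map_a₃] at h
    exact PadicInt.coe_eq_zero.mp h
  have hE₀V : E₀ = { a₁ := 0, a₂ := 0, a₃ := 0, a₄ := (V₀.a₄ : ℚ_[p]), a₆ := (V₀.a₆ : ℚ_[p]) } := by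
    rw [← hV₀c]
    ext <;> simp [WeierstrassCurve.map, hV₁, hV₂, hV₃]
  have hAB : V₀.a₄ ≠ 0 ∨ V₀.a₆ ≠ 0 := by
    by_contra hcon
    rw [not_or, not_not, not_not] at hcon
    apply hWpΔ0
    rw [← hE₀Δ, E₀.Δ_of_isShortNF, hE₀V]
    simp [hcon.1, hcon.2]
  haveI hWpmin : Wp.IsMinimal ℤ_[p] := by
    rw [hWp, hφ]; exact isMinimal_map_padic_of_isGloballyMinimal W' p
  have hmin : ¬ ((p : ℤ_[p]) ^ 4 ∣ V₀.a₄ ∧ (p : ℤ_[p]) ^ 6 ∣ V₀.a₆) :=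
    not_pow_dvd_of_isMinimal Wp hWpΔ0 Wp.toShortNF (toShortNF_u Wp) (hE₀T.symm.trans hE₀V)
  obtain ⟨k, i, j, A₁, B₁, hk12, hik, hjk, hA, hB, hFH⟩ :=
    exists_semistableTwistData hp5 V₀.a₄ V₀.a₆ hAB hmin
  obtain ⟨π, hπ⟩ := IsAlgClosed.exists_pow_nat_eq ((p : ℕ) : PadicAlgCl p) (by norm_num : 0 < 12)
  set E : IntermediateField ℚ_[p] (PadicAlgCl p) := ℚ_[p]⟮π⟯ with hEdef
  haveI hEfd : FiniteDimensional ℚ_[p] E :=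
    IntermediateField.adjoin.finiteDimensional (Algebra.IsAlgebraic.isAlgebraic π).isIntegral
  set O := padicCoeffRing E with hOdef
  letI hOloc : IsLocalRing O := isLocalRing_padicCoeffRing E
  haveI hOpid : IsPrincipalIdealRing O := isPrincipalIdealRing_padicCoeffRing E
  haveI hOcpl : IsAdicComplete (maximalIdeal O) O := isAdicComplete_padicCoeffRing E
  letI hOch : CharP (ResidueField O) p := charP_residueField_padicCoeffRing E
  have hp1R : (1 : ℝ) < p := by exact_mod_cast (Fact.out : p.Prime).one_lt
  have hπnorm : ‖π‖ ^ 12 = (p : ℝ)⁻¹ := by rw [← norm_pow, hπ, norm_natCast_padicAlgCl]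
  have hπle : ‖π‖ ≤ 1 := by
    by_contra hcon
    rw [not_le] at hcon
    have h1 : (1 : ℝ) < ‖π‖ ^ 12 := one_lt_pow₀ hcon (by norm_num)
    rw [hπnorm] at h1
    exact absurd h1 (not_lt.mpr (inv_le_one_of_one_le₀ hp1R.le))
  have hπlt : ‖π‖ < 1 := by
    by_contra hcon
    rw [not_lt] at hcon
    have h1 : (1 : ℝ) ≤ ‖π‖ ^ 12 := one_le_pow₀ hcon
    rw [hπnorm] at h1
    exact absurd h1 (not_le.mpr (inv_lt_one_of_one_lt₀ hp1R))
  have hπ0 : π ≠ 0 := by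
    intro h
    rw [h, zero_pow (by norm_num)] at hπ
    exact (Fact.out : p.Prime).ne_zero (by exact_mod_cast hπ.symm)
  set πE : E := ⟨π, IntermediateField.mem_adjoin_simple_self ℚ_[p] π⟩ with hπEdef
  have hπEc : ((πE : E) : PadicAlgCl p) = π := rfl
  have hπE0 : (πE : E) ≠ 0 := fun h ↦ hπ0 (by rw [← hπEc, h]; rfl)
  set πO : O := ⟨πE, (mem_padicCoeffRing_iff E πE).mpr (by rw [hπEc]; exact hπle)⟩ with hπOdef
  have hπOc : ((πO : O) : E) = πE := rfl
  have hπOmax : πO ∈ maximalIdeal O := by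
    rw [mem_maximalIdeal_padicCoeffRing_iff, hπOc, hπEc]; exact hπlt
  set ι : ℤ_[p] →+* O := padicIntToCoeffRing E with hιdef
  set φE : ℚ_[p] →+* E := algebraMap ℚ_[p] E with hφE
  have halgO : ∀ y : O, algebraMap O E y = (y : E) := fun y ↦ rfl
  have hinjO : Function.Injective (algebraMap O E) := fun x y h ↦ Subtype.ext h
  have hιφ : ∀ x : ℤ_[p], algebraMap O E (ι x) = φE (x : ℚ_[p]) := fun x ↦ rfl
  have hιφ' : (algebraMap O E).comp ι = φE.comp (algebraMap ℤ_[p] ℚ_[p]) := RingHom.ext hιφ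
  have hπE12 : (πE : E) ^ 12 = ((p : ℕ) : E) := by
    apply (algebraMap E (PadicAlgCl p)).injective
    rw [map_pow, map_natCast]
    exact hπ
  have hpE : ((p : ℕ) : E) = φE ((p : ℕ) : ℚ_[p]) := (map_natCast φE p).symm
  set A'' : O := πO ^ (12 * i - 4 * k) * ι A₁ with hA''
  set B'' : O := πO ^ (12 * j - 6 * k) * ι B₁ with hB''
  set V'' : WeierstrassCurve O := { a₁ := 0, a₂ := 0, a₃ := 0, a₄ := A'', a₆ := B'' } with hV''
  set V₁ : WeierstrassCurve ℤ_[p] :=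
    { a₁ := 0, a₂ := 0, a₃ := 0, a₄ := if 12 * i = 4 * k then A₁ else 0,
      a₆ := if 12 * j = 6 * k then B₁ else 0 } with hV₁
  set jj : ZMod p →+* ResidueField O := ZMod.castHom (dvd_refl p) (ResidueField O) with hjj
  have hres : ∀ (m : ℕ) (x : ℤ_[p]), residue O (πO ^ m * ι x) =
      jj (PadicInt.toZMod (if m = 0 then x else 0)) := by
    intro m x
    rcases Nat.eq_zero_or_pos m with rfl | hm
    · rw [pow_zero, one_mul, if_pos rfl, hιdef, residue_padicIntToCoeffRing]
    · rw [if_neg hm.ne', map_zero, map_zero, map_mul, map_pow, (residue_eq_zero_iff _).mpr hπOmax,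
        zero_pow hm.ne', zero_mul]
  have hV''r : V''.map (residue O) = (V₁.map PadicInt.toZMod).map jj := by
    rw [hV'', hV₁]
    ext
    · show residue O 0 = jj (PadicInt.toZMod 0)
      rw [map_zero, map_zero, map_zero]
    · show residue O 0 = jj (PadicInt.toZMod 0)
      rw [map_zero, map_zero, map_zero]
    · show residue O 0 = jj (PadicInt.toZMod 0)
      rw [map_zero, map_zero, map_zero]
    · show residue O (πO ^ (12 * i - 4 * k) * ι A₁) =
        jj (PadicInt.toZMod (if 12 * i = 4 * k then A₁ else 0))
      rw [hres]
      congr 2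
      by_cases h : 12 * i = 4 * k
      · rw [if_pos (show 12 * i - 4 * k = 0 by omega), if_pos h]
      · rw [if_neg (show ¬ 12 * i - 4 * k = 0 by omega), if_neg h]
    · show residue O (πO ^ (12 * j - 6 * k) * ι B₁) =
        jj (PadicInt.toZMod (if 12 * j = 6 * k then B₁ else 0))
      rw [hres]
      congr 2
      by_cases h : 12 * j = 6 * k
      · rw [if_pos (show 12 * j - 6 * k = 0 by omega), if_pos h]
      · rw [if_neg (show ¬ 12 * j - 6 * k = 0 by omega), if_neg h]
  obtain ⟨nn, hnn, hunit⟩ : ∃ nn : ℕ, 0 < nn ∧ IsUnit (coeff nn (V''.formalMul d)) := by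
    have hP : (V''.map (residue O)).formalMul p ≠ 0 := by
      rw [hV''r, ← map_formalMul]
      intro h0'
      apply hFH
      apply PowerSeries.map_injective (jj : ZMod p →+* ResidueField O) jj.injective
      rw [h0', map_zero]
    have hD : (V''.map (residue O)).formalMul d ≠ 0 :=
      (V''.map (residue O)).formalMul_ne_zero_of_formalMul_prime_ne_zero hP hd0
    obtain ⟨nn, hnn⟩ := exists_coeff_ne_zero_iff_ne_zero.mpr hD
    rw [← map_formalMul, coeff_map] at hnn
    refine ⟨nn, Nat.pos_of_ne_zero ?_, ?_⟩
    · rintro rfl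
      apply hnn
      rw [coeff_zero_eq_constantCoeff_apply, V''.constantCoeff_formalMul d, map_zero]
    · by_contra hu
      apply hnn
      exact (residue_eq_zero_iff _).mpr ((IsLocalRing.mem_maximalIdeal _).mpr hu)
  set E₀E : WeierstrassCurve E := E₀.map φE with hE₀E
  set πEu : Eˣ := Units.mk0 ((πE : E) ^ k) (pow_ne_zero _ hπE0) with hπEu
  have hV''E : V''.map (algebraMap O E) = (⟨πEu, 0, 0, 0⟩ : VariableChange E) • E₀E := by
    rw [hE₀E, hE₀V]
    have hmapE : ({ a₁ := 0, a₂ := 0, a₃ := 0, a₄ := (V₀.a₄ : ℚ_[p]), a₆ := (V₀.a₆ : ℚ_[p]) } :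
        WeierstrassCurve ℚ_[p]).map φE =
        { a₁ := 0, a₂ := 0, a₃ := 0, a₄ := φE (V₀.a₄ : ℚ_[p]), a₆ := φE (V₀.a₆ : ℚ_[p]) } := by
      ext <;> simp [WeierstrassCurve.map]
    rw [hmapE, smul_shortModel, hV'']
    have h4 : (A'' : E) = (πEu⁻¹ : Eˣ) ^ 4 * φE (V₀.a₄ : ℚ_[p]) := by
      rw [← halgO, hA'', map_mul, map_pow, halgO, hπOc, hιφ, hA]
      push_cast
      rw [map_mul, map_pow, ← hpE, ← hπE12, hπEu, Units.val_mk0, ← pow_mul,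
        show 12 * i = (12 * i - 4 * k) + k * 4 by omega, pow_add, pow_mul, inv_pow,
        mul_comm ((πE : E) ^ (12 * i - 4 * k)) (((πE : E) ^ k) ^ 4), mul_assoc (((πE : E) ^ k) ^ 4),
        ← mul_assoc (((πE : E) ^ k) ^ 4)⁻¹, inv_mul_cancel₀ (pow_ne_zero 4 (pow_ne_zero k hπE0)),
        one_mul, show 12 * i - 4 * k + k * 4 - 4 * k = 12 * i - 4 * k by omega]
    have h6 : (B'' : E) = (πEu⁻¹ : Eˣ) ^ 6 * φE (V₀.a₆ : ℚ_[p]) := by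
      rw [← halgO, hB'', map_mul, map_pow, halgO, hπOc, hιφ, hB]
      push_cast
      rw [map_mul, map_pow, ← hpE, ← hπE12, hπEu, Units.val_mk0, ← pow_mul,
        show 12 * j = (12 * j - 6 * k) + k * 6 by omega, pow_add, pow_mul, inv_pow,
        mul_comm ((πE : E) ^ (12 * j - 6 * k)) (((πE : E) ^ k) ^ 6), mul_assoc (((πE : E) ^ k) ^ 6),
        ← mul_assoc (((πE : E) ^ k) ^ 6)⁻¹, inv_mul_cancel₀ (pow_ne_zero 6 (pow_ne_zero k hπE0)),
        one_mul, show 12 * j - 6 * k + k * 6 - 6 * k = 12 * j - 6 * k by omega]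
    refine WeierstrassCurve.ext ?_ ?_ ?_ ?_ ?_
    · show algebraMap O E 0 = 0
      rw [map_zero]
    · show algebraMap O E 0 = 0
      rw [map_zero]
    · show algebraMap O E 0 = 0
      rw [map_zero]
    · show algebraMap O E A'' = _
      rw [halgO, h4]
    · show algebraMap O E B'' = _
      rw [halgO, h6]
  set z₀E : E⟦X⟧ := z₀.map φE with hz₀E
  have hz₀E0 : constantCoeff z₀E = 0 := by
    rw [hz₀E, ← coeff_zero_eq_constantCoeff, coeff_map, coeff_zero_eq_constantCoeff, hz₀0, map_zero]
  have hz₀Es : HasSubst z₀E := HasSubst.of_constantCoeff_zero' hz₀E0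
  set z'' : E⟦X⟧ := C ((πE : E) ^ k) * z₀E with hz''
  have hz''0 : constantCoeff z'' = 0 := by rw [hz'', map_mul, hz₀E0, mul_zero]
  have hz''s : HasSubst z'' := HasSubst.of_constantCoeff_zero' hz''0
  have hz''1 : coeff 1 z'' = (πE : E) ^ k * φE (Cp.u : ℚ_[p]) := by
    rw [hz'', coeff_C_mul, hz₀E, coeff_map, hz₀1]
  set w'' : O⟦X⟧ := C (πO ^ k) * w₁.map ι with hw''
  have hmm : ∀ R : ℤ_[p]⟦X⟧, (R.map ι).map (algebraMap O E) =
      (R.map (algebraMap ℤ_[p] ℚ_[p])).map φE := fun R ↦ by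
    ext n
    simp only [coeff_map, hιφ]
    rfl
  have hwE : (w₁.map ι).map (algebraMap O E) = w.map φE := by
    rw [hmm, ← hw₁]
    rfl
  have hXs : HasSubst (C ((πE : E) ^ k) * X : E⟦X⟧) :=
    HasSubst.of_constantCoeff_zero' (by rw [map_mul, constantCoeff_X, mul_zero])
  have hCπ : (C (πO ^ k) : O⟦X⟧).map (algebraMap O E) = C ((πE : E) ^ k) := by
    rw [map_C, map_pow, halgO, hπOc]
  have hGz : (V''.formalMul d).subst z'' = w''.map (algebraMap O E) := by
    rw [← subst_map_algebraMap (V''.formalMul d) hz''s, map_formalMul, hV''E, hz'',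
      show C ((πE : E) ^ k) * z₀E = (C ((πE : E) ^ k) * X : E⟦X⟧).subst z₀E by
        rw [subst_mul hz₀Es, subst_C' hz₀Es, subst_X hz₀Es],
      ← subst_comp_subst_apply hXs hz₀Es,
      show (((⟨πEu, 0, 0, 0⟩ : VariableChange E) • E₀E).formalMul d).subst (C ((πE : E) ^ k) * X) =
          C ((πE : E) ^ k) * E₀E.formalMul d from E₀E.formalMul_uScale_smul_subst πEu d,
      subst_mul hz₀Es, subst_C' hz₀Es, hE₀E, ← map_formalMul, hz₀E, ← powerSeries_map_subst hz₀s φE,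
      hGw, hw'', map_mul, hCπ, hwE]
  set Q'' : O⟦X⟧ := Q₁.map ι with hQ''
  set P'' : O⟦X⟧ := C (πO ^ k) * P₁.map ι with hP''
  have hQ''0 : Q'' ≠ 0 := by
    rw [hQ'']
    intro h0'
    apply hQ₁0
    apply PowerSeries.map_injective ι (padicIntToCoeffRing_injective E)
    rw [h0', map_zero]
  have hQ''E : Q''.map (algebraMap O E) = (Q₁.map (algebraMap ℤ_[p] ℚ_[p])).map φE := by
    rw [hQ'']; exact hmm Q₁
  have hP''E : P''.map (algebraMap O E) =
      C ((πE : E) ^ k) * (P₁.map (algebraMap ℤ_[p] ℚ_[p])).map φE := by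
    rw [hP'', map_mul, hCπ, hmm]
  have hPQ'' : z'' * Q''.map (algebraMap O E) = P''.map (algebraMap O E) := by
    have h := congrArg (PowerSeries.map φE) hPQ₁
    rw [map_mul, ← hz₀E] at h
    rw [hQ''E, hP''E, hz'', mul_assoc, h]
  obtain ⟨z₃, hz₃⟩ := Literature.RingTheory.PowerSeries.exists_map_eq_of_subst_eq_map (O := O) (L := E)
    hinjO hnn hunit hz''0 hGz hQ''0 hPQ''
  have h1 : algebraMap O E (coeff 1 z₃) = (πE : E) ^ k * φE (Cp.u : ℚ_[p]) := by
    rw [← hz''1, ← hz₃, coeff_map]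
  have hnormle : ‖π‖ ^ k * ‖(Cp.u : ℚ_[p])‖ ≤ 1 := by
    have h2 := norm_coe_padicCoeffRing_le E (coeff 1 z₃)
    rw [← halgO, h1] at h2
    push_cast at h2
    rw [hπEc, norm_mul, norm_pow, IntermediateField.coe_algebraMap_apply] at h2
    change ‖π‖ ^ k * ‖((Cp.u : ℚ_[p]) : PadicAlgCl p)‖ ≤ 1 at h2
    rwa [PadicAlgCl.norm_extends] at h2
  exact Padic.norm_le_one_of_pow_mul_norm_le_one (norm_nonneg π) hπnorm hk12 hnormle

end Summit.BirchSwinnertonDyer.BirchSwinnertonDyer.Theorems.ManinLocalTwoThree.StevensIntegrality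
end
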